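import Literature.NumberTheory.Automorphic.UnitaryLatticeTreeTubeCoordinate     -- ★ p848197 (this seat): (c1-i…ii′), (c2)
import Literature.NumberTheory.Automorphic.UnitaryLatticeTreeFramed             -- ★ `exists_eq_latt_of_latt_le_of_le_latt`
import Literature.NumberTheory.Automorphic.UnitaryLatticeTreeFixedVertex        -- ★ `scaleLattice_le_self_of_v_le_one`
import HarnessLib

/-!
# The lattice graph of a hermitian space — THE AXIS VERTEX `A(M) = (M ∩ W) + ϖ^b·M + 𝒪e₁` OF A SELF-DUAL LATTICE (block form) IS A SELF-DUAL AXIS LATTICE `latt ι(g₂, 1)`,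
# and its W-side index `B(M) = (M ∩ W) + ϖ^b·pr_W M` (Bruhat–Tits 1972 §10; Kottwitz 1986 §3; Jacobowitz 1962 §4, §7; Serre, *Trees* II.1.1)

Topic `NumberTheory/Automorphic`; namespace `Literature.NumberTheory.Automorphic.UnitaryLatticeTree`.  THEOREMS ONLY (no definition, no instance, no notation, no named fact,
no `sorry`); kernel lane `--supports stmt-HodgeConjecture-24833`; datum-free (`K` with `Valued K ℤᵐ⁰`; the two heads that produce a basis carry `[IsPrincipalIdealRing 𝒪[K]]`,
discharged downstream by ★ `isPrincipalIdealRing_integer_adicCompletion`).  Cell `pub/hodgecm-mathlib`, crux H413; road «S3-ram» (count-neutral), (T2) G-side organ (Cnt2′) of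
chair F0P3a-p07 (g14), sub-organ **(z1-c) TUBE LAYERS `b ≥ 1`**, part (c1-iii)(c1-iii′) of the census `F0/P3a/F0P2-p01/g16/z1c/CENSUS-z1c-TubeLayers.v1.F0P2p01g16.md` (ruling (6)
«=»); sequel of ★ `UnitaryLatticeTreeTubeCoordinate` (p848197).  Seat F0P2-p01 (g16).
HONEST LABEL: HC_CM is proved only modulo the 2 remaining named inputs (hLiu418 24832, h413 24833) until rung 0 closes; elementary lattice algebra, no books consequence.

THE MATHEMATICS.  Block currency as in ★ `UnitaryLatticeTreeTubeCoordinate`: `H = !![H₂ 0 0, 0, H₂ 0 1; 0, h, 0; H₂ 1 0, 0, H₂ 1 1]` (hermitian, `det H₂ ≠ 0`, `|h| = 1`),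
`M` SELF-DUAL with tube coordinate `b` (`c·e₁ ∈ M ⟺ |c| ≤ |ϖ|^b`), generator `x₀` (`M = (M ∩ W) + 𝒪x₀`, `|x₀,₁| = |ϖ|^{-b}`), `A(M) := (M ∩ W) ⊔ ϖ^b·M ⊔ 𝒪e₁` (a TERM).
* (c1-iii) `isSelfDualLattice_axisVertex_of_tubeCoordinate`: `e₁ ∈ A(M)`, `|x₁| ≤ 1` on `A(M)`, and `A(M)` is SELF-DUAL.  `A ≤ A^♯` generator by generator; `A^♯ ≤ A` by the
  GENERATOR TRICK (`M^♯ = (M ∩ W)^♯ ∩ (𝒪x₀)^♯`: for `x ∈ A^♯`, `y = pr_W x`, `u = ϖ^b·pr_W x₀ ∈ A`, `λ = ⟨x₀, y⟩ ∕ ⟨x₀, u⟩` has `|λ| ≤ 1` since `|⟨x₀, y⟩| ≤ |ϖ|^{-b}` and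
  `|⟨x₀, u⟩| = |ϖ|^{-b}` (`v_pairing_generator_proj`), and `y − λu ∈ M ∩ W`); at `b = 0`, `A(M) = M`.  Then `A = latt g` (★ `exists_eq_latt_of_latt_le_of_le_latt`, PID) and
  `A^♯ = A` ⇒ unimodular Gram matrix (`isSelfDualLattice_latt_of_dualLatt_eq`).
* (c1-iii′) `exists_axisVertex_eq_latt_endoGL`: `A(M) = latt ι(g₂, 1)` with `latt g₂` self-dual for `H₂` (★ (z1-a) + ★ (z1-b) §5), and `y ∈ latt g₂ ⟺ (y 0, 0, y 1) = w + ϖ^b·pr_W m`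
  (`w ∈ M ∩ W`, `m ∈ M`): `A(M) ∩ W = B(M) = (M ∩ W) + ϖ^b·pr_W M` (`mem_axisVertex_iff_of_apply_one_eq_zero`) — the index of the cone of `M` in (z1-d)'s W-side counts.

## References
* [BruhatTits1972] F. Bruhat, J. Tits, *Groupes réductifs sur un corps local I*, Publ. Math. IHÉS 41 (1972), §10 (lattice models; the building of a rank-one group is a tree).
* [Kottwitz1986] R. E. Kottwitz, *Base change for unit elements of Hecke algebras*, Compositio Math. 60 (1986), §3 (fixed lattices of a block element; reduction to Levi blocks).
* [Jacobowitz1962] R. Jacobowitz, *Hermitian forms over local fields*, Amer. J. Math. 84 (1962), §4 (dual lattices, gluing), §7 (unimodular lattices).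
* [Serre1980Trees] J.-P. Serre, *Trees* (1980), Ch. II §1.1 (lattices and bases).
-/

set_option autoImplicit false

noncomputable section

open scoped Valued WithZero Matrix MatrixGroups

namespace Literature.NumberTheory.Automorphic.UnitaryLatticeTree

open Literature.NumberTheory.Automorphic Literature.NumberTheory.Automorphic.HermitianLattice Literature.NumberTheory.Rogawski1990

variable {K : Type*} [Field K] [Valued K ℤᵐ⁰]

/-! ## §1 Dual-lattice bookkeeping -/

/-- For a form with `|⟨y, x⟩| = |⟨x, y⟩|`: `S ≤ T^♯ → T ≤ S^♯`. [cite: Jacobowitz1962, §4] -/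
theorem le_dualLatt_comm {N : ℕ} {σ : K →+* K} {H : Matrix (Fin N) (Fin N) K} (hsymm : ∀ x y : Fin N → K, Valued.v (pairing σ H y x) = Valued.v (pairing σ H x y))
    {S T : Submodule 𝒪[K] (Fin N → K)} (h : S ≤ dualLatt σ H T) : T ≤ dualLatt σ H S := fun y hy x hx => by
  rw [hsymm]; exact h hx y hy

omit [Valued K ℤᵐ⁰] in
/-- The block form is hermitian when `H₂` is and `σ h = h`. [cite: Jacobowitz1962, §4] -/
theorem endoShapeForm_hermitian {σ : K →+* K} {H₂ : Matrix (Fin 2) (Fin 2) K} (hH₂σ : (H₂.map σ)ᵀ = H₂) {h : K} (hhσ : σ h = h) (a b : Fin 3) :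
    σ ((!![H₂ 0 0, 0, H₂ 0 1; 0, h, 0; H₂ 1 0, 0, H₂ 1 1] : Matrix (Fin 3) (Fin 3) K) a b) =
      (!![H₂ 0 0, 0, H₂ 0 1; 0, h, 0; H₂ 1 0, 0, H₂ 1 1] : Matrix (Fin 3) (Fin 3) K) b a := by
  have hs : ∀ i j : Fin 2, σ (H₂ i j) = H₂ j i := fun i j => by
    have := congrArg (fun M : Matrix (Fin 2) (Fin 2) K => M j i) hH₂σ
    simpa [Matrix.transpose_apply, Matrix.map_apply] using this
  fin_cases a <;> fin_cases b <;> simp [hs, hhσ]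

/-- The dual of the line `𝒪e₁` for the block form: `x ∈ (𝒪e₁)^♯ ⟺ |x₁| ≤ 1`. [cite: Jacobowitz1962, §4] -/
theorem mem_dualLatt_span_single_one_iff (σ : K →+* K) (hvσ : ∀ a, Valued.v (σ a) = Valued.v a) {H₂ : Matrix (Fin 2) (Fin 2) K} {h : K} (hh : Valued.v h = 1)
    (x : Fin 3 → K) :
    x ∈ dualLatt σ (!![H₂ 0 0, 0, H₂ 0 1; 0, h, 0; H₂ 1 0, 0, H₂ 1 1] : Matrix (Fin 3) (Fin 3) K) (Submodule.span 𝒪[K] {(Pi.single 1 1 : Fin 3 → K)}) ↔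
      Valued.v (x 1) ≤ 1 := by
  have key : ∀ y : Fin 3 → K, Valued.v (pairing σ (!![H₂ 0 0, 0, H₂ 0 1; 0, h, 0; H₂ 1 0, 0, H₂ 1 1] : Matrix (Fin 3) (Fin 3) K) (Pi.single 1 1) y) = Valued.v (y 1) :=
    fun y => by
    rw [pairing_single_left_of_block σ _ 1 (fun l hl => endoShapeForm_row H₂ h l hl), endoShapeForm_one_one, map_one, one_mul, map_mul, hh, one_mul]
  rw [mem_dualLatt]
  constructor
  · intro hx; rw [← key]; exact hx _ (Submodule.mem_span_singleton_self _)
  · intro hx y hy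
    obtain ⟨a, rfl⟩ := Submodule.mem_span_singleton.1 hy
    have e : (a • (Pi.single 1 1 : Fin 3 → K)) = (a : K) • (Pi.single 1 1 : Fin 3 → K) := rfl
    rw [e, map_smulₛₗ, LinearMap.smul_apply, smul_eq_mul, map_mul, key, hvσ]
    exact mul_le_one' ((mem_integer_iff' _).1 a.2) hx

/-- Membership in `W = ker(proj₁)`: `x ∈ W ⟺ x₁ = 0`. [cite: BruhatTits1972, §10] -/
theorem mem_kerProj_one_iff (x : Fin 3 → K) :
    x ∈ LinearMap.ker ((LinearMap.proj (1 : Fin 3) : (Fin 3 → K) →ₗ[K] K).restrictScalars 𝒪[K]) ↔ x 1 = 0 := by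
  rw [LinearMap.mem_ker]; rfl

/-- A lattice `latt g` equal to its own dual is SELF-DUAL (Gram matrix integral and unimodular). [cite: Jacobowitz1962, §7] [cite: BruhatTits1972, §10] -/
theorem isSelfDualLattice_latt_of_dualLatt_eq {N : ℕ} (σ : K →+* K) (hvσ : ∀ a, Valued.v (σ a) = Valued.v a) {ϖ : K} (hϖ0 : ϖ ≠ 0) (hϖ1 : Valued.v ϖ ≤ 1)
    {H : Matrix (Fin N) (Fin N) K} (hH : IsUnit H.det) (g : GL (Fin N) K)
    (h : dualLatt σ H (latt (g : Matrix (Fin N) (Fin N) K)) = latt (g : Matrix (Fin N) (Fin N) K)) :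
    IsSelfDualLattice σ ϖ H (latt (g : Matrix (Fin N) (Fin N) K)) := by
  rw [IsSelfDualLattice, isVertexLattice_latt_iff_of_v σ hvσ hϖ0 H 0 g]
  have hg : IsUnit (g : Matrix (Fin N) (Fin N) K).det := Matrix.isUnits_det_units g
  have hint : IsIntMatrix (formCongr σ g H) := (latt_le_dualLatt_latt_iff σ hvσ H _).1 (by rw [h])
  have hinv : IsIntMatrix (ϖ • (formCongr σ g H)⁻¹) :=
    (scaleLattice_dualLatt_latt_le_iff σ hvσ hH hg ϖ).1 (by rw [h]; exact scaleLattice_le_self_of_v_le_one hϖ1 _)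
  have hGinv : IsIntMatrix (formCongr σ g H)⁻¹ := by
    have h1 : latt ((g : Matrix (Fin N) (Fin N) K) * (formCongr σ g H)⁻¹) ≤ latt (g : Matrix (Fin N) (Fin N) K) := by
      rw [← dualLatt_latt σ hvσ hH g, h]
    have h2 := (latt_le_latt_iff hg _).1 h1
    rwa [← Matrix.mul_assoc, Matrix.nonsing_inv_mul _ hg, Matrix.one_mul] at h2
  refine ⟨hint, hinv, ?_⟩
  rw [pow_zero]
  have hGdet : (formCongr σ g H).det ≠ 0 := by
    rw [formCongr, Matrix.det_mul, Matrix.det_mul]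
    exact mul_ne_zero (mul_ne_zero (isUnit_det_transpose_map σ hg).ne_zero hH.ne_zero) hg.ne_zero
  have := v_det_eq_one_of_isIntMatrix_inv (E := Matrix.GeneralLinearGroup.mkOfDetNeZero _ hGdet)
    (by rw [Matrix.GeneralLinearGroup.val_mkOfDetNeZero]; exact hint) (by rw [Matrix.coe_units_inv, Matrix.GeneralLinearGroup.val_mkOfDetNeZero]; exact hGinv)
  rwa [Matrix.GeneralLinearGroup.val_mkOfDetNeZero] at this

/-! ## §2 The axis vertex is self-dual -/

/-- The generator's W-part pairs with the generator to size `|ϖ|^{-2b}`: `|⟨x₀, pr_W x₀⟩| = |ϖ|^{-b}·|ϖ|^{-b}` (`⟨x₀, pr_W x₀⟩ = ⟨x₀,x₀⟩ − σ(x₀,₁)·h·x₀,₁`, the first term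
integral, the second of size `|ϖ|^{-2b} > 1`). [cite: Jacobowitz1962, §4] [cite: BruhatTits1972, §10] -/
theorem v_pairing_generator_proj (σ : K →+* K) (hvσ : ∀ a, Valued.v (σ a) = Valued.v a) {ϖ : K} (hϖ : Valued.v ϖ = WithZero.exp (-1 : ℤ))
    {H₂ : Matrix (Fin 2) (Fin 2) K} {h : K} (hh : Valued.v h = 1)
    {M : Submodule 𝒪[K] (Fin 3 → K)} (hM : IsSelfDualLattice σ ϖ (!![H₂ 0 0, 0, H₂ 0 1; 0, h, 0; H₂ 1 0, 0, H₂ 1 1] : Matrix (Fin 3) (Fin 3) K) M) {b : ℕ} (hb1 : 1 ≤ b)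
    {x₀ : Fin 3 → K} (hx₀ : x₀ ∈ M) (hx₀1 : Valued.v (x₀ 1) * Valued.v ϖ ^ b = 1) :
    Valued.v (pairing σ (!![H₂ 0 0, 0, H₂ 0 1; 0, h, 0; H₂ 1 0, 0, H₂ 1 1] : Matrix (Fin 3) (Fin 3) K) x₀ (x₀ - Pi.single 1 (x₀ 1))) =
      (Valued.v ϖ ^ b)⁻¹ * (Valued.v ϖ ^ b)⁻¹ := by
  have hHcol : ∀ l : Fin 3, l ≠ 1 → (!![H₂ 0 0, 0, H₂ 0 1; 0, h, 0; H₂ 1 0, 0, H₂ 1 1] : Matrix (Fin 3) (Fin 3) K) l 1 = 0 := fun l hl => endoShapeForm_col H₂ h l hl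
  have hH11 : (!![H₂ 0 0, 0, H₂ 0 1; 0, h, 0; H₂ 1 0, 0, H₂ 1 1] : Matrix (Fin 3) (Fin 3) K) 1 1 = h := endoShapeForm_one_one H₂ h
  have hϖ0 : Valued.v ϖ ≠ 0 := by rw [hϖ]; exact WithZero.exp_ne_zero
  have hϖb0 : Valued.v ϖ ^ b ≠ 0 := pow_ne_zero _ hϖ0
  have hpos : 0 < Valued.v ϖ ^ b := zero_lt_iff.2 hϖb0
  have hx₀v : Valued.v (x₀ 1) = (Valued.v ϖ ^ b)⁻¹ := eq_inv_of_mul_eq_one_left hx₀1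
  have hMd : M ≤ dualLatt σ (!![H₂ 0 0, 0, H₂ 0 1; 0, h, 0; H₂ 1 0, 0, H₂ 1 1] : Matrix (Fin 3) (Fin 3) K) M := le_dualLatt_of_isVertexLattice hvσ hM
  have hself : Valued.v (pairing σ (!![H₂ 0 0, 0, H₂ 0 1; 0, h, 0; H₂ 1 0, 0, H₂ 1 1] : Matrix (Fin 3) (Fin 3) K) x₀ x₀) ≤ 1 := (mem_dualLatt σ (!![H₂ 0 0, 0, H₂ 0 1; 0, h, 0; H₂ 1 0, 0, H₂ 1 1] : Matrix (Fin 3) (Fin 3) K) M x₀).1 (hMd hx₀) x₀ hx₀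
  have hbig : Valued.v (σ (x₀ 1) * (!![H₂ 0 0, 0, H₂ 0 1; 0, h, 0; H₂ 1 0, 0, H₂ 1 1] : Matrix (Fin 3) (Fin 3) K) 1 1 * x₀ 1) = (Valued.v ϖ ^ b)⁻¹ * (Valued.v ϖ ^ b)⁻¹ := by
    rw [hH11, map_mul, map_mul, hvσ, hh, mul_one, hx₀v]
  have hlt1 : Valued.v ϖ ^ b < 1 := by
    rw [← pow_zero (Valued.v ϖ), v_pow_eq_exp_neg hϖ, v_pow_eq_exp_neg hϖ, WithZero.exp_lt_exp]; omega
  have hinv1 : 1 < (Valued.v ϖ ^ b)⁻¹ := one_lt_inv_iff₀.2 ⟨hpos, hlt1⟩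
  have hgt : Valued.v (pairing σ (!![H₂ 0 0, 0, H₂ 0 1; 0, h, 0; H₂ 1 0, 0, H₂ 1 1] : Matrix (Fin 3) (Fin 3) K) x₀ x₀) < Valued.v (σ (x₀ 1) * (!![H₂ 0 0, 0, H₂ 0 1; 0, h, 0; H₂ 1 0, 0, H₂ 1 1] : Matrix (Fin 3) (Fin 3) K) 1 1 * x₀ 1) := by
    rw [hbig]; exact lt_of_le_of_lt hself (one_lt_mul_of_lt_of_le hinv1 hinv1.le)
  rw [pairing_sub_single_right_of_block σ (!![H₂ 0 0, 0, H₂ 0 1; 0, h, 0; H₂ 1 0, 0, H₂ 1 1] : Matrix (Fin 3) (Fin 3) K) 1 hHcol x₀ x₀, Valuation.map_sub_eq_of_lt_right _ hgt, hbig]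

/-- **(c1-iii) THE AXIS VERTEX OF `M` IS A SELF-DUAL AXIS LATTICE**: `A(M) := (M ∩ W) ⊔ ϖ^b·M ⊔ 𝒪e₁` contains `e₁`, has integral middle coordinates, and is self-dual for the block
form.  Proof: `A ≤ A^♯` generator by generator; `A^♯ ≤ A` by the generator trick — for `x ∈ A^♯`, `y := pr_W x − λ·ϖ^b pr_W x₀` with `λ := ⟨x₀, pr_W x⟩ ∕ ⟨x₀, ϖ^b pr_W x₀⟩ ∈ 𝒪`
is `⟨x₀, ·⟩`-null and `(M ∩ W)`-integral, hence in `M^♯ = M` (`M = (M ∩ W) ⊔ 𝒪x₀`); finally `A = latt g` (PID) and ★ `isVertexLattice_latt_iff_of_v`.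
[cite: Jacobowitz1962, §4] [cite: BruhatTits1972, §10] [cite: Serre1980Trees, Ch. II §1.1] -/
theorem isSelfDualLattice_axisVertex_of_tubeCoordinate [IsPrincipalIdealRing 𝒪[K]] (σ : K →+* K) (hσ : ∀ a, σ (σ a) = a) (hvσ : ∀ a, Valued.v (σ a) = Valued.v a)
    {ϖ : K} (hϖ : Valued.v ϖ = WithZero.exp (-1 : ℤ))
    {H₂ : Matrix (Fin 2) (Fin 2) K} (hH₂ : IsUnit H₂.det) (hH₂σ : (H₂.map σ)ᵀ = H₂) {h : K} (hh : Valued.v h = 1) (hhσ : σ h = h)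
    {M : Submodule 𝒪[K] (Fin 3 → K)} (hM : IsSelfDualLattice σ ϖ (!![H₂ 0 0, 0, H₂ 0 1; 0, h, 0; H₂ 1 0, 0, H₂ 1 1] : Matrix (Fin 3) (Fin 3) K) M)
    {b : ℕ} (hb : ∀ c : K, (Pi.single 1 c : Fin 3 → K) ∈ M ↔ Valued.v c ≤ Valued.v ϖ ^ b) :
    (Pi.single 1 1 : Fin 3 → K) ∈ M ⊓ LinearMap.ker ((LinearMap.proj (1 : Fin 3) : (Fin 3 → K) →ₗ[K] K).restrictScalars 𝒪[K]) ⊔ scaleLattice (ϖ ^ b) M ⊔ Submodule.span 𝒪[K] {(Pi.single 1 1 : Fin 3 → K)} ∧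
    (∀ x ∈ M ⊓ LinearMap.ker ((LinearMap.proj (1 : Fin 3) : (Fin 3 → K) →ₗ[K] K).restrictScalars 𝒪[K]) ⊔ scaleLattice (ϖ ^ b) M ⊔ Submodule.span 𝒪[K] {(Pi.single 1 1 : Fin 3 → K)},
      Valued.v (x 1) ≤ 1) ∧
    IsSelfDualLattice σ ϖ (!![H₂ 0 0, 0, H₂ 0 1; 0, h, 0; H₂ 1 0, 0, H₂ 1 1] : Matrix (Fin 3) (Fin 3) K)
      (M ⊓ LinearMap.ker ((LinearMap.proj (1 : Fin 3) : (Fin 3 → K) →ₗ[K] K).restrictScalars 𝒪[K]) ⊔ scaleLattice (ϖ ^ b) M ⊔ Submodule.span 𝒪[K] {(Pi.single 1 1 : Fin 3 → K)}) := by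
  set Wk : Submodule 𝒪[K] (Fin 3 → K) := LinearMap.ker ((LinearMap.proj (1 : Fin 3) : (Fin 3 → K) →ₗ[K] K).restrictScalars 𝒪[K]) with hWk
  set E : Submodule 𝒪[K] (Fin 3 → K) := Submodule.span 𝒪[K] {(Pi.single 1 1 : Fin 3 → K)} with hE
  set A : Submodule 𝒪[K] (Fin 3 → K) := M ⊓ Wk ⊔ scaleLattice (ϖ ^ b) M ⊔ E with hA
  have hHcol : ∀ l : Fin 3, l ≠ 1 → (!![H₂ 0 0, 0, H₂ 0 1; 0, h, 0; H₂ 1 0, 0, H₂ 1 1] : Matrix (Fin 3) (Fin 3) K) l 1 = 0 := fun l hl => endoShapeForm_col H₂ h l hl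
  have hHrow : ∀ l : Fin 3, l ≠ 1 → (!![H₂ 0 0, 0, H₂ 0 1; 0, h, 0; H₂ 1 0, 0, H₂ 1 1] : Matrix (Fin 3) (Fin 3) K) 1 l = 0 := fun l hl => endoShapeForm_row H₂ h l hl
  have hH11 : (!![H₂ 0 0, 0, H₂ 0 1; 0, h, 0; H₂ 1 0, 0, H₂ 1 1] : Matrix (Fin 3) (Fin 3) K) 1 1 = h := endoShapeForm_one_one H₂ h
  have hHdet : IsUnit ((!![H₂ 0 0, 0, H₂ 0 1; 0, h, 0; H₂ 1 0, 0, H₂ 1 1] : Matrix (Fin 3) (Fin 3) K)).det := isUnit_det_endoShapeForm hH₂ hh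
  have hsymm : ∀ x y : Fin 3 → K, Valued.v (pairing σ (!![H₂ 0 0, 0, H₂ 0 1; 0, h, 0; H₂ 1 0, 0, H₂ 1 1] : Matrix (Fin 3) (Fin 3) K) y x) = Valued.v (pairing σ (!![H₂ 0 0, 0, H₂ 0 1; 0, h, 0; H₂ 1 0, 0, H₂ 1 1] : Matrix (Fin 3) (Fin 3) K) x y) :=
    v_pairing_comm_of_hermitian hvσ hσ (endoShapeForm_hermitian hH₂σ hhσ)
  have hϖ0' : Valued.v ϖ ≠ 0 := by rw [hϖ]; exact WithZero.exp_ne_zero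
  have hϖ0 : ϖ ≠ 0 := fun h0 => by rw [h0, map_zero] at hϖ0'; exact hϖ0' rfl
  have hϖ1 : Valued.v ϖ ≤ 1 := by rw [hϖ, ← WithZero.exp_zero, WithZero.exp_le_exp]; omega
  have hϖb0 : Valued.v ϖ ^ b ≠ 0 := pow_ne_zero _ hϖ0'
  have hϖb0' : ϖ ^ b ≠ 0 := pow_ne_zero _ hϖ0
  have hϖb1 : Valued.v (ϖ ^ b) ≤ 1 := by rw [map_pow]; exact pow_le_one₀ zero_le hϖ1
  obtain ⟨b', hb', hpr', x₀, hx₀, hx₀1'⟩ := exists_tubeCoordinate σ hvσ hϖ hH₂ hh hM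
  obtain ⟨hbb, he₁M⟩ := tubeCoordinate_unique hϖ hb hb'
  subst hbb
  have hMd : M ≤ dualLatt σ (!![H₂ 0 0, 0, H₂ 0 1; 0, h, 0; H₂ 1 0, 0, H₂ 1 1] : Matrix (Fin 3) (Fin 3) K) M := le_dualLatt_of_isVertexLattice hvσ hM
  have hMeq : dualLatt σ (!![H₂ 0 0, 0, H₂ 0 1; 0, h, 0; H₂ 1 0, 0, H₂ 1 1] : Matrix (Fin 3) (Fin 3) K) M = M := dualLatt_eq_self_of_isSelfDualLattice hvσ hHdet hM
  have hWmem : ∀ x : Fin 3 → K, x ∈ Wk ↔ x 1 = 0 := fun x => mem_kerProj_one_iff x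
  have he₁A : (Pi.single 1 1 : Fin 3 → K) ∈ A := Submodule.mem_sup_right (Submodule.mem_span_singleton_self _)
  have hEmem : ∀ c : K, Valued.v c ≤ 1 → (Pi.single 1 c : Fin 3 → K) ∈ E := fun c hc => by
    have e : (Pi.single 1 c : Fin 3 → K) = (⟨c, (mem_integer_iff' _).2 hc⟩ : 𝒪[K]) • (Pi.single 1 1 : Fin 3 → K) := by
      ext k; change _ = (c • (Pi.single 1 1 : Fin 3 → K)) k
      rcases eq_or_ne k 1 with rfl | hk <;> simp [*]
    rw [e]; exact Submodule.smul_mem _ _ (Submodule.mem_span_singleton_self _)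
  have hA1 : ∀ x ∈ A, Valued.v (x 1) ≤ 1 := by
    intro x hx
    obtain ⟨y, hy, l, hl, rfl⟩ := Submodule.mem_sup.1 hx
    obtain ⟨w, hw, s, hs, rfl⟩ := Submodule.mem_sup.1 hy
    have hw1 : w 1 = 0 := (hWmem w).1 hw.2
    have hs1 : Valued.v (s 1) ≤ 1 := by
      have hs' := (mem_scaleLattice_iff hϖb0' M s).1 hs
      have := hpr' _ hs'
      rw [Pi.smul_apply, smul_eq_mul, map_mul, map_inv₀, map_pow, mul_comm, ← mul_assoc, mul_inv_cancel₀ hϖb0, one_mul] at this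
      exact this
    have hl1 : Valued.v (l 1) ≤ 1 := by
      obtain ⟨a, rfl⟩ := Submodule.mem_span_singleton.1 hl
      change Valued.v (((a : K) • (Pi.single 1 1 : Fin 3 → K)) 1) ≤ 1
      rw [Pi.smul_apply, Pi.single_eq_same, smul_eq_mul, mul_one]
      exact (mem_integer_iff' _).1 a.2
    rw [Pi.add_apply, Pi.add_apply, hw1, zero_add]
    exact (Valuation.map_add _ _ _).trans (max_le hs1 hl1)
  refine ⟨he₁A, hA1, ?_⟩
  rcases Nat.eq_zero_or_pos b with hb0 | hb1
  · subst hb0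
    have hAM : A = M := by
      refine le_antisymm (sup_le (sup_le inf_le_left ?_) ?_) ?_
      · rw [pow_zero]; exact scaleLattice_le_self_of_v_le_one (le_of_eq (map_one _)) M
      · rw [hE, Submodule.span_le, Set.singleton_subset_iff]; exact he₁M.2 rfl
      · intro x hx
        refine Submodule.mem_sup_left (Submodule.mem_sup_right ?_)
        rw [pow_zero, mem_scaleLattice_iff one_ne_zero, inv_one, one_smul]; exact hx
    rw [hAM]; exact hM
  have hS1 : M ⊓ Wk ≤ dualLatt σ (!![H₂ 0 0, 0, H₂ 0 1; 0, h, 0; H₂ 1 0, 0, H₂ 1 1] : Matrix (Fin 3) (Fin 3) K) (M ⊓ Wk) := fun x hx => dualLatt_antitone σ (!![H₂ 0 0, 0, H₂ 0 1; 0, h, 0; H₂ 1 0, 0, H₂ 1 1] : Matrix (Fin 3) (Fin 3) K) inf_le_left (hMd hx.1)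
  have hS2 : scaleLattice (ϖ ^ b) M ≤ dualLatt σ (!![H₂ 0 0, 0, H₂ 0 1; 0, h, 0; H₂ 1 0, 0, H₂ 1 1] : Matrix (Fin 3) (Fin 3) K) (M ⊓ Wk) := fun x hx =>
    dualLatt_antitone σ (!![H₂ 0 0, 0, H₂ 0 1; 0, h, 0; H₂ 1 0, 0, H₂ 1 1] : Matrix (Fin 3) (Fin 3) K) inf_le_left (hMd (scaleLattice_le_self_of_v_le_one hϖb1 M hx))
  have hS3 : E ≤ dualLatt σ (!![H₂ 0 0, 0, H₂ 0 1; 0, h, 0; H₂ 1 0, 0, H₂ 1 1] : Matrix (Fin 3) (Fin 3) K) (M ⊓ Wk) := by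
    refine le_dualLatt_comm hsymm fun w hw => ?_
    rw [hE, mem_dualLatt_span_single_one_iff σ hvσ hh, (hWmem w).1 hw.2, map_zero]; exact zero_le
  have hT2 : scaleLattice (ϖ ^ b) M ≤ dualLatt σ (!![H₂ 0 0, 0, H₂ 0 1; 0, h, 0; H₂ 1 0, 0, H₂ 1 1] : Matrix (Fin 3) (Fin 3) K) (scaleLattice (ϖ ^ b) M) := fun x hx =>
    dualLatt_antitone σ (!![H₂ 0 0, 0, H₂ 0 1; 0, h, 0; H₂ 1 0, 0, H₂ 1 1] : Matrix (Fin 3) (Fin 3) K) (scaleLattice_le_self_of_v_le_one hϖb1 M) (hMd (scaleLattice_le_self_of_v_le_one hϖb1 M hx))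
  have hT3 : E ≤ dualLatt σ (!![H₂ 0 0, 0, H₂ 0 1; 0, h, 0; H₂ 1 0, 0, H₂ 1 1] : Matrix (Fin 3) (Fin 3) K) (scaleLattice (ϖ ^ b) M) := by
    refine le_dualLatt_comm hsymm fun s hs => ?_
    rw [hE, mem_dualLatt_span_single_one_iff σ hvσ hh]
    exact hA1 s (Submodule.mem_sup_left (Submodule.mem_sup_right hs))
  have hU3 : E ≤ dualLatt σ (!![H₂ 0 0, 0, H₂ 0 1; 0, h, 0; H₂ 1 0, 0, H₂ 1 1] : Matrix (Fin 3) (Fin 3) K) E := fun l hl => by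
    rw [hE, mem_dualLatt_span_single_one_iff σ hvσ hh]; exact hA1 l (Submodule.mem_sup_right hl)
  have hAint : A ≤ dualLatt σ (!![H₂ 0 0, 0, H₂ 0 1; 0, h, 0; H₂ 1 0, 0, H₂ 1 1] : Matrix (Fin 3) (Fin 3) K) A := by
    rw [hA, dualLatt_sup, dualLatt_sup]
    refine le_inf (le_inf (sup_le (sup_le hS1 hS2) hS3) (sup_le (sup_le (le_dualLatt_comm hsymm hS2) hT2) hT3)) ?_
    exact sup_le (sup_le (le_dualLatt_comm hsymm hS3) (le_dualLatt_comm hsymm hT3)) hU3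
  have hgen := (exists_smul_add_of_tubeCoordinate σ hvσ hϖ hh hM hb1 hb hpr' hx₀ hx₀1').1
  have hx₀v : Valued.v (x₀ 1) = (Valued.v ϖ ^ b)⁻¹ := eq_inv_of_mul_eq_one_left hx₀1'
  have hN := v_pairing_generator_proj σ hvσ hϖ hh hM hb1 hx₀ hx₀1'
  have hN0 : pairing σ (!![H₂ 0 0, 0, H₂ 0 1; 0, h, 0; H₂ 1 0, 0, H₂ 1 1] : Matrix (Fin 3) (Fin 3) K) x₀ (x₀ - Pi.single 1 (x₀ 1)) ≠ 0 := fun h0 => by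
    rw [h0, map_zero] at hN; exact (mul_ne_zero (inv_ne_zero hϖb0) (inv_ne_zero hϖb0)) hN.symm
  have hu1 : ((ϖ ^ b) • (x₀ - Pi.single 1 (x₀ 1)) : Fin 3 → K) 1 = 0 := by simp
  have huA : (ϖ ^ b) • (x₀ - Pi.single 1 (x₀ 1)) ∈ A := by
    have e : (ϖ ^ b) • (x₀ - Pi.single 1 (x₀ 1)) = (ϖ ^ b) • x₀ - Pi.single 1 (ϖ ^ b * x₀ 1) := by
      ext k; rcases eq_or_ne k 1 with rfl | hk <;> simp [*]
    rw [e]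
    refine Submodule.sub_mem _ (Submodule.mem_sup_left (Submodule.mem_sup_right ?_)) (Submodule.mem_sup_right (hEmem _ ?_))
    · rw [mem_scaleLattice_iff hϖb0', smul_smul, inv_mul_cancel₀ hϖb0', one_smul]; exact hx₀
    · rw [map_mul, map_pow, hx₀v, mul_inv_cancel₀ hϖb0]
  have hdual : dualLatt σ (!![H₂ 0 0, 0, H₂ 0 1; 0, h, 0; H₂ 1 0, 0, H₂ 1 1] : Matrix (Fin 3) (Fin 3) K) A ≤ A := by
    intro x hx
    rw [hA, dualLatt_sup, dualLatt_sup] at hx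
    have hx1 : x ∈ dualLatt σ (!![H₂ 0 0, 0, H₂ 0 1; 0, h, 0; H₂ 1 0, 0, H₂ 1 1] : Matrix (Fin 3) (Fin 3) K) (M ⊓ Wk) := (Submodule.mem_inf.1 (Submodule.mem_inf.1 hx).1).1
    have hx2 : x ∈ dualLatt σ (!![H₂ 0 0, 0, H₂ 0 1; 0, h, 0; H₂ 1 0, 0, H₂ 1 1] : Matrix (Fin 3) (Fin 3) K) (scaleLattice (ϖ ^ b) M) := (Submodule.mem_inf.1 (Submodule.mem_inf.1 hx).1).2
    have hx3 : x ∈ dualLatt σ (!![H₂ 0 0, 0, H₂ 0 1; 0, h, 0; H₂ 1 0, 0, H₂ 1 1] : Matrix (Fin 3) (Fin 3) K) E := (Submodule.mem_inf.1 hx).2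
    have hxv : Valued.v (x 1) ≤ 1 := by rw [hE, mem_dualLatt_span_single_one_iff σ hvσ hh] at hx3; exact hx3
    have hx₀x : Valued.v (pairing σ (!![H₂ 0 0, 0, H₂ 0 1; 0, h, 0; H₂ 1 0, 0, H₂ 1 1] : Matrix (Fin 3) (Fin 3) K) x₀ x) ≤ (Valued.v ϖ ^ b)⁻¹ := by
      have hmem : (ϖ ^ b) • x₀ ∈ scaleLattice (ϖ ^ b) M := by
        rw [mem_scaleLattice_iff hϖb0', smul_smul, inv_mul_cancel₀ hϖb0', one_smul]; exact hx₀
      have h1 := (mem_dualLatt σ (!![H₂ 0 0, 0, H₂ 0 1; 0, h, 0; H₂ 1 0, 0, H₂ 1 1] : Matrix (Fin 3) (Fin 3) K) _ x).1 hx2 _ hmem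
      rw [map_smulₛₗ, LinearMap.smul_apply, smul_eq_mul, map_mul, hvσ, map_pow] at h1
      rwa [← one_mul (Valued.v ϖ ^ b)⁻¹, le_mul_inv_iff₀ (zero_lt_iff.2 hϖb0), mul_comm]
    set y : Fin 3 → K := x - Pi.single 1 (x 1) with hy
    have hy1 : y 1 = 0 := by simp [hy]
    have hα : Valued.v (pairing σ (!![H₂ 0 0, 0, H₂ 0 1; 0, h, 0; H₂ 1 0, 0, H₂ 1 1] : Matrix (Fin 3) (Fin 3) K) x₀ y) ≤ (Valued.v ϖ ^ b)⁻¹ := by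
      rw [hy, pairing_sub_single_right_of_block σ (!![H₂ 0 0, 0, H₂ 0 1; 0, h, 0; H₂ 1 0, 0, H₂ 1 1] : Matrix (Fin 3) (Fin 3) K) 1 hHcol x₀ x, hH11]
      refine (Valuation.map_sub _ _ _).trans (max_le hx₀x ?_)
      rw [map_mul, map_mul, hvσ, hh, hx₀v, mul_one]
      exact (mul_le_mul' le_rfl hxv).trans (le_of_eq (mul_one _))
    have hx₀u : pairing σ (!![H₂ 0 0, 0, H₂ 0 1; 0, h, 0; H₂ 1 0, 0, H₂ 1 1] : Matrix (Fin 3) (Fin 3) K) x₀ ((ϖ ^ b) • (x₀ - Pi.single 1 (x₀ 1))) = ϖ ^ b * pairing σ (!![H₂ 0 0, 0, H₂ 0 1; 0, h, 0; H₂ 1 0, 0, H₂ 1 1] : Matrix (Fin 3) (Fin 3) K) x₀ (x₀ - Pi.single 1 (x₀ 1)) := by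
      rw [LinearMap.map_smul, smul_eq_mul]
    have hx₀u0 : pairing σ (!![H₂ 0 0, 0, H₂ 0 1; 0, h, 0; H₂ 1 0, 0, H₂ 1 1] : Matrix (Fin 3) (Fin 3) K) x₀ ((ϖ ^ b) • (x₀ - Pi.single 1 (x₀ 1))) ≠ 0 := by rw [hx₀u]; exact mul_ne_zero hϖb0' hN0
    set lam : K := pairing σ (!![H₂ 0 0, 0, H₂ 0 1; 0, h, 0; H₂ 1 0, 0, H₂ 1 1] : Matrix (Fin 3) (Fin 3) K) x₀ y / pairing σ (!![H₂ 0 0, 0, H₂ 0 1; 0, h, 0; H₂ 1 0, 0, H₂ 1 1] : Matrix (Fin 3) (Fin 3) K) x₀ ((ϖ ^ b) • (x₀ - Pi.single 1 (x₀ 1))) with hlam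
    have hlamv : Valued.v lam ≤ 1 := by
      rw [hlam, map_div₀, hx₀u, map_mul, map_pow, hN, ← mul_assoc, mul_inv_cancel₀ hϖb0, one_mul,
        div_le_iff₀ (zero_lt_iff.2 (inv_ne_zero hϖb0)), one_mul]
      exact hα
    set y' : Fin 3 → K := y - lam • ((ϖ ^ b) • (x₀ - Pi.single 1 (x₀ 1))) with hy'
    have hy'1 : y' 1 = 0 := by simp [hy', hy1, hu1]
    have hnull : pairing σ (!![H₂ 0 0, 0, H₂ 0 1; 0, h, 0; H₂ 1 0, 0, H₂ 1 1] : Matrix (Fin 3) (Fin 3) K) x₀ y' = 0 := by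
      rw [hy', map_sub, LinearMap.map_smul, smul_eq_mul, hlam, div_mul_cancel₀ _ hx₀u0, sub_self]
    have hyW : ∀ w ∈ M ⊓ Wk, Valued.v (pairing σ (!![H₂ 0 0, 0, H₂ 0 1; 0, h, 0; H₂ 1 0, 0, H₂ 1 1] : Matrix (Fin 3) (Fin 3) K) w y') ≤ 1 := by
      intro w hw
      have hw1 : w 1 = 0 := (hWmem w).1 hw.2
      have h1 : Valued.v (pairing σ (!![H₂ 0 0, 0, H₂ 0 1; 0, h, 0; H₂ 1 0, 0, H₂ 1 1] : Matrix (Fin 3) (Fin 3) K) w y) ≤ 1 := by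
        rw [hy, pairing_sub_single_right_of_block σ (!![H₂ 0 0, 0, H₂ 0 1; 0, h, 0; H₂ 1 0, 0, H₂ 1 1] : Matrix (Fin 3) (Fin 3) K) 1 hHcol w x, hw1, map_zero, zero_mul, zero_mul, sub_zero]
        exact (mem_dualLatt σ (!![H₂ 0 0, 0, H₂ 0 1; 0, h, 0; H₂ 1 0, 0, H₂ 1 1] : Matrix (Fin 3) (Fin 3) K) _ x).1 hx1 w hw
      have h2 : Valued.v (pairing σ (!![H₂ 0 0, 0, H₂ 0 1; 0, h, 0; H₂ 1 0, 0, H₂ 1 1] : Matrix (Fin 3) (Fin 3) K) w ((ϖ ^ b) • (x₀ - Pi.single 1 (x₀ 1)))) ≤ 1 := by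
        rw [LinearMap.map_smul, smul_eq_mul, pairing_sub_single_right_of_block σ (!![H₂ 0 0, 0, H₂ 0 1; 0, h, 0; H₂ 1 0, 0, H₂ 1 1] : Matrix (Fin 3) (Fin 3) K) 1 hHcol w x₀, hw1, map_zero, zero_mul, zero_mul, sub_zero,
          map_mul, map_pow]
        exact mul_le_one' (pow_le_one₀ zero_le hϖ1) ((mem_dualLatt σ (!![H₂ 0 0, 0, H₂ 0 1; 0, h, 0; H₂ 1 0, 0, H₂ 1 1] : Matrix (Fin 3) (Fin 3) K) M x₀).1 (hMd hx₀) w hw.1)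
      rw [hy', map_sub, LinearMap.map_smul, smul_eq_mul]
      refine (Valuation.map_sub _ _ _).trans (max_le h1 ?_)
      rw [map_mul]; exact mul_le_one' hlamv h2
    have hy'M : y' ∈ M := by
      rw [← hMeq, mem_dualLatt]
      intro m hm
      obtain ⟨t, w, ht, hwM, hw1, rfl⟩ := hgen m hm
      rw [map_add, LinearMap.add_apply, map_smulₛₗ, LinearMap.smul_apply, smul_eq_mul, hnull, mul_zero, zero_add]
      exact hyW w ⟨hwM, (hWmem w).2 hw1⟩
    have hyA : y ∈ A := by
      have e : y = y' + lam • ((ϖ ^ b) • (x₀ - Pi.single 1 (x₀ 1))) := by rw [hy', sub_add_cancel]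
      rw [e]
      exact A.add_mem (Submodule.mem_sup_left (Submodule.mem_sup_left ⟨hy'M, (hWmem y').2 hy'1⟩)) (smul_mem_of_v_le A hlamv huA)
    have e : x = y + Pi.single 1 (x 1) := by rw [hy, sub_add_cancel]
    rw [e]
    exact A.add_mem hyA (Submodule.mem_sup_right (hEmem _ hxv))
  obtain ⟨g, hMg, -, -, -⟩ := id hM
  have hdetg : (g : Matrix (Fin 3) (Fin 3) K).det ≠ 0 := (Matrix.isUnits_det_units g).ne_zero
  have hlo : latt ((Matrix.GeneralLinearGroup.mkOfDetNeZero ((ϖ ^ b) • (g : Matrix (Fin 3) (Fin 3) K))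
      (by rw [Matrix.det_smul]; exact mul_ne_zero (pow_ne_zero _ hϖb0') hdetg) : GL (Fin 3) K) : Matrix (Fin 3) (Fin 3) K) ≤ A := by
    rw [Matrix.GeneralLinearGroup.val_mkOfDetNeZero, ← scaleLattice_latt, ← hMg]
    exact le_sup_of_le_left le_sup_right
  have hhi : A ≤ latt ((Matrix.GeneralLinearGroup.mkOfDetNeZero ((ϖ ^ b)⁻¹ • (g : Matrix (Fin 3) (Fin 3) K))
      (by rw [Matrix.det_smul]; exact mul_ne_zero (pow_ne_zero _ (inv_ne_zero hϖb0')) hdetg) : GL (Fin 3) K) : Matrix (Fin 3) (Fin 3) K) := by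
    rw [Matrix.GeneralLinearGroup.val_mkOfDetNeZero, ← scaleLattice_latt, ← hMg]
    have hsub : ∀ x ∈ M, x ∈ scaleLattice (ϖ ^ b)⁻¹ M := fun x hx => by
      rw [mem_scaleLattice_iff (inv_ne_zero hϖb0'), inv_inv]; exact smul_mem_of_v_le M hϖb1 hx
    refine sup_le (sup_le (fun x hx => hsub x hx.1) (fun x hx => hsub x (scaleLattice_le_self_of_v_le_one hϖb1 M hx))) ?_
    rw [hE, Submodule.span_le, Set.singleton_subset_iff, SetLike.mem_coe, mem_scaleLattice_iff (inv_ne_zero hϖb0'), inv_inv]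
    have e : (ϖ ^ b) • (Pi.single 1 1 : Fin 3 → K) = Pi.single 1 (ϖ ^ b) := by
      ext k; rcases eq_or_ne k 1 with rfl | hk <;> simp [*]
    rw [e, hb, map_pow]
  obtain ⟨g', hAg'⟩ := exists_eq_latt_of_latt_le_of_le_latt _ _ A hlo hhi
  rw [hAg'] at hAint hdual ⊢
  exact isSelfDualLattice_latt_of_dualLatt_eq σ hvσ hϖ0 hϖ1 hHdet g' (le_antisymm hdual hAint)

/-- Membership of a `W`-vector in the axis vertex: `z ∈ A(M)` (`z₁ = 0`) iff `z = w + ϖ^b·pr_W m` with `w ∈ M ∩ W`, `m ∈ M` — `A(M) ∩ W = B(M) = (M ∩ W) + ϖ^b·pr_W M`.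
[cite: BruhatTits1972, §10] [cite: Serre1980Trees, Ch. II §1.1] -/
theorem mem_axisVertex_iff_of_apply_one_eq_zero {ϖ : K} (hϖ : Valued.v ϖ = WithZero.exp (-1 : ℤ)) {M : Submodule 𝒪[K] (Fin 3 → K)} {b : ℕ}
    (hpr : ∀ x ∈ M, Valued.v (x 1) * Valued.v ϖ ^ b ≤ 1) {z : Fin 3 → K} (hz1 : z 1 = 0) :
    z ∈ M ⊓ LinearMap.ker ((LinearMap.proj (1 : Fin 3) : (Fin 3 → K) →ₗ[K] K).restrictScalars 𝒪[K]) ⊔ scaleLattice (ϖ ^ b) M ⊔ Submodule.span 𝒪[K] {(Pi.single 1 1 : Fin 3 → K)} ↔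
      ∃ w ∈ M, ∃ m ∈ M, w 1 = 0 ∧ z = w + (ϖ ^ b) • (m - Pi.single 1 (m 1)) := by
  have hϖ0' : Valued.v ϖ ≠ 0 := by rw [hϖ]; exact WithZero.exp_ne_zero
  have hϖ0 : ϖ ≠ 0 := fun h0 => by rw [h0, map_zero] at hϖ0'; exact hϖ0' rfl
  have hϖb0 : Valued.v ϖ ^ b ≠ 0 := pow_ne_zero _ hϖ0'
  have hϖb0' : ϖ ^ b ≠ 0 := pow_ne_zero _ hϖ0
  have hsplit : ∀ m : Fin 3 → K, (ϖ ^ b) • (m - Pi.single 1 (m 1)) = (ϖ ^ b) • m - Pi.single 1 (ϖ ^ b * m 1) := fun m => by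
    ext k; rcases eq_or_ne k 1 with rfl | hk <;> simp [*]
  have hEmem : ∀ c : K, Valued.v c ≤ 1 → (Pi.single 1 c : Fin 3 → K) ∈ Submodule.span 𝒪[K] {(Pi.single 1 1 : Fin 3 → K)} := fun c hc => by
    have e : (Pi.single 1 c : Fin 3 → K) = (⟨c, (mem_integer_iff' _).2 hc⟩ : 𝒪[K]) • (Pi.single 1 1 : Fin 3 → K) := by
      ext k; change _ = (c • (Pi.single 1 1 : Fin 3 → K)) k
      rcases eq_or_ne k 1 with rfl | hk <;> simp [*]
    rw [e]; exact Submodule.smul_mem _ _ (Submodule.mem_span_singleton_self _)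
  constructor
  · intro hz
    obtain ⟨y, hy, l, hl, hzy⟩ := Submodule.mem_sup.1 hz
    obtain ⟨w, hw, s, hs, rfl⟩ := Submodule.mem_sup.1 hy
    obtain ⟨a, rfl⟩ := Submodule.mem_span_singleton.1 hl
    have hw1 : w 1 = 0 := (mem_kerProj_one_iff w).1 hw.2
    have hs' := (mem_scaleLattice_iff hϖb0' M s).1 hs
    have hl' : a • (Pi.single 1 1 : Fin 3 → K) = Pi.single 1 (a : K) := by
      ext k; change ((a : K) • (Pi.single 1 1 : Fin 3 → K)) k = _
      rcases eq_or_ne k 1 with rfl | hk <;> simp [*]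
    rw [hl'] at hzy
    refine ⟨w, hw.1, (ϖ ^ b)⁻¹ • s, hs', hw1, ?_⟩
    have h1 := congrArg (fun v : Fin 3 → K => v 1) hzy
    simp only [Pi.add_apply, hw1, zero_add, hz1, Pi.single_eq_same] at h1
    have ha : ((a : K)) = -(s 1) := by linear_combination h1
    rw [hsplit, smul_smul, mul_inv_cancel₀ hϖb0', one_smul, Pi.smul_apply, smul_eq_mul, ← mul_assoc, mul_inv_cancel₀ hϖb0', one_mul, ← hzy, ha,
      Pi.single_neg, add_assoc, sub_eq_add_neg]
  · rintro ⟨w, hwM, m, hmM, hw1, rfl⟩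
    rw [hsplit]
    refine Submodule.add_mem _ (Submodule.mem_sup_left (Submodule.mem_sup_left ⟨hwM, (mem_kerProj_one_iff w).2 hw1⟩))
      (Submodule.sub_mem _ (Submodule.mem_sup_left (Submodule.mem_sup_right ?_)) (Submodule.mem_sup_right (hEmem _ ?_)))
    · rw [mem_scaleLattice_iff hϖb0', smul_smul, inv_mul_cancel₀ hϖb0', one_smul]; exact hmM
    · rw [map_mul, map_pow, mul_comm]; exact hpr m hmM

/-- **(c1-iii′) THE W-SIDE INDEX `B(M)`**: `A(M) = latt ι(g₂, 1)` for some `g₂ ∈ GL₂(K)` with `latt g₂` self-dual for `H₂` (★ (z1-a) `exists_latt_endoGL_eq_of_single_mem`, ★ (z1-b) §5),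
and `y ∈ latt g₂ ⟺ (y 0, 0, y 1) = w + ϖ^b·pr_W m` for some `w ∈ M ∩ W`, `m ∈ M` — the index of the cone of `M` in (z1-d)'s W-side count. [cite: BruhatTits1972, §10] [cite: Serre1980Trees, Ch. II §1.1] -/
theorem exists_axisVertex_eq_latt_endoGL [IsPrincipalIdealRing 𝒪[K]] (σ : K →+* K) (hσ : ∀ a, σ (σ a) = a) (hvσ : ∀ a, Valued.v (σ a) = Valued.v a)
    {ϖ : K} (hϖ : Valued.v ϖ = WithZero.exp (-1 : ℤ))
    {H₂ : Matrix (Fin 2) (Fin 2) K} (hH₂ : IsUnit H₂.det) (hH₂σ : (H₂.map σ)ᵀ = H₂) {h : K} (hh : Valued.v h = 1) (hhσ : σ h = h)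
    {M : Submodule 𝒪[K] (Fin 3 → K)} (hM : IsSelfDualLattice σ ϖ (!![H₂ 0 0, 0, H₂ 0 1; 0, h, 0; H₂ 1 0, 0, H₂ 1 1] : Matrix (Fin 3) (Fin 3) K) M)
    {b : ℕ} (hb : ∀ c : K, (Pi.single 1 c : Fin 3 → K) ∈ M ↔ Valued.v c ≤ Valued.v ϖ ^ b) :
    ∃ g₂ : GL (Fin 2) K, IsSelfDualLattice σ ϖ H₂ (latt (g₂ : Matrix (Fin 2) (Fin 2) K)) ∧
      latt ((endoGL (g₂, (1 : GL (Fin 1) K)) : GL (Fin 3) K) : Matrix (Fin 3) (Fin 3) K) =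
        M ⊓ LinearMap.ker ((LinearMap.proj (1 : Fin 3) : (Fin 3 → K) →ₗ[K] K).restrictScalars 𝒪[K]) ⊔ scaleLattice (ϖ ^ b) M ⊔ Submodule.span 𝒪[K] {(Pi.single 1 1 : Fin 3 → K)} ∧
      (∀ y : Fin 2 → K, y ∈ latt (g₂ : Matrix (Fin 2) (Fin 2) K) ↔
        ∃ w ∈ M, ∃ m ∈ M, w 1 = 0 ∧ (![y 0, 0, y 1] : Fin 3 → K) = w + (ϖ ^ b) • (m - Pi.single 1 (m 1))) := by
  have hϖ0' : Valued.v ϖ ≠ 0 := by rw [hϖ]; exact WithZero.exp_ne_zero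
  have hϖ0 : ϖ ≠ 0 := fun h0 => by rw [h0, map_zero] at hϖ0'; exact hϖ0' rfl
  have hϖ1 : Valued.v ϖ ≤ 1 := by rw [hϖ, ← WithZero.exp_zero, WithZero.exp_le_exp]; omega
  obtain ⟨he, hA1, hSD⟩ := isSelfDualLattice_axisVertex_of_tubeCoordinate σ hσ hvσ hϖ hH₂ hH₂σ hh hhσ hM hb
  obtain ⟨g', hAg', -, -, -⟩ := id hSD
  obtain ⟨g₂, hg₂⟩ := exists_latt_endoGL_eq_of_single_mem g' (by rw [← hAg']; exact he) (by rw [← hAg']; exact hA1)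
  obtain ⟨b', hb', hpr', -⟩ := exists_tubeCoordinate σ hvσ hϖ hH₂ hh hM
  obtain ⟨hbb, -⟩ := tubeCoordinate_unique hϖ hb hb'
  subst hbb
  refine ⟨g₂, ?_, by rw [hg₂, hAg'], fun y => ?_⟩
  · exact (isSelfDualLattice_latt_endoGL_one_iff σ hvσ hϖ0 hϖ1 H₂ hh g₂).1 (by rw [hg₂, ← hAg']; exact hSD)
  · have key := mem_latt_endoGL_one_iff g₂ (![y 0, 0, y 1] : Fin 3 → K)
    have e2 : (![(![y 0, 0, y 1] : Fin 3 → K) 0, (![y 0, 0, y 1] : Fin 3 → K) 2] : Fin 2 → K) = y := by ext i; fin_cases i <;> rfl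
    have e1 : (![y 0, 0, y 1] : Fin 3 → K) 1 = 0 := rfl
    rw [e2, e1, map_zero] at key
    rw [← key.trans (and_iff_left zero_le_one), hg₂, ← hAg']
    exact mem_axisVertex_iff_of_apply_one_eq_zero hϖ hpr' e1

end Literature.NumberTheory.Automorphic.UnitaryLatticeTree

end
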